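import Literature.InformationTheory.QuantumCodes.BivariateBicycleCode360
import Literature.InformationTheory.QuantumCodes.TwoBlockConnectedComponents
import Literature.InformationTheory.QuantumCodes.TwoBlockToricLayout
import HarnessLib
import HarnessLib.Audit.Tags

/-!
# The published bivariate-bicycle codes have CONNECTED Tanner graphs and a TORIC LAYOUT
# (Bravyi et al. 2024, §5: Lemma 3 / Lemma 4 instances for `[[72,12,6]]`, `[[90,8,10]]`, `[[108,8,10]]`,
# `[[144,12,12]]`, `[[288,12,18]]` and the upper-bound row `[[360,12,≤24]]`) — venture QEC, census family BB,
# layout column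

HONEST FRAMING (qec cell). Column word for every statement below: PROVED (kernel theorems on the
tree's data objects `BB.bb72 … BB.bb288`, `BivariateBicycleCodes.lean`, and `BB.bb360`,
`BivariateBicycleCode360.lean`; the seventh row `[[756,16,≤34]]` is not typed — no lit page). They assert GRAPH-THEORETIC
properties of the Tanner graphs printed in Bravyi–Cross–Gambetta–Maslov–Rall–Yoder, Nature 627
(2024) [BravyiEtAl2024, §5]: "although all codes in Table are connected" (arXiv:2308.07915 chunk
p0011 L7) and "All codes in Table have a toric layout with `μ = m` and `λ = ℓ`. Most of these codes
satisfy Lemma 4 with `i = g = 2` and `j = h = 3`. The exception is the `[[90,8,10]]` code, for which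
we can take `i = 2, g = 1` and `j = h = 3`" (p0011 L39). They say NOTHING about distances (those are
the CLAIMS of `Census/BB/Claims.lean`, discharged by certificates) and nothing about thickness / planar
embeddings (Lemma 2, not typed: Mathlib has no planarity notion).

For each code `C ∈ {bb72, bb90, bb108, bb144, bb288, bb360}` on `ℤ_ℓ × ℤ_m`:
* `C_tannerGraph_connected : C.css.tannerGraph.Connected` — by the tree's Lemma 3
  (`BB.Code.tannerGraph_connected_of_unit_mem`, `TwoBlockConnectedComponents.lean`): the exponent
  differences of `A` and of `B` generate `x = (1,0)` and `y = (0,1)`;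
* `C_hasToricLayoutWith : HasToricLayoutWith m ℓ C.css.tannerGraph` — by the tree's Lemma 4
  (`BB.Code.hasToricLayoutWith_of_exponents`, `TwoBlockToricLayout.lean`) with the printed choice of
  monomials: `A_iA_jᵀ` ↦ exponent difference of order `m`, `B_gB_hᵀ` ↦ exponent difference of order
  `ℓ`, the two generating `ℤ_ℓ × ℤ_m`, orders multiplying to `ℓm`; and `C_hasToricLayout`.

The small arithmetic facts (values of the polynomials at exponents, orders of elements of
`ℤ_ℓ × ℤ_m`, `n • d = (1,0)`) are `decide`d on the literal data.

## References
* [BravyiEtAl2024] Nature 627 (2024) 778 = arXiv:2308.07915, §5 (chunk p0011 L7, L9–10, L28–39),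
  Table 3 / Extended Data Table 1 (the five codes; data locators in `BivariateBicycleCodes.lean`).
-/

namespace Summit.Ventures.QEC.BB

open Literature.InformationTheory.QuantumCodes
open Literature.InformationTheory.QuantumCodes.BB

/-! ### Orders of the layout generators in `ℤ_ℓ × ℤ_m` (decided) -/

/-- `ord((0,1) − (0,2)) = 6` in `ℤ₆ × ℤ₆` (`A₂A₃ᵀ = y⁻¹`, order `m = 6`). [cite: BravyiEtAl2024, §5 after Lemma 4 "toric layout with μ = m" (arXiv:2308.07915 chunk p0011 L39)] -/
theorem addOrderOf_y_6_6 : addOrderOf (((0 : Fin 6), (1 : Fin 6)) - (0, 2)) = 6 :=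
  (addOrderOf_eq_iff (by norm_num)).mpr (by decide)

/-- `ord((1,0) − (2,0)) = 6` in `ℤ₆ × ℤ₆` (`B₂B₃ᵀ = x⁻¹`, order `ℓ = 6`). [cite: BravyiEtAl2024, §5 after Lemma 4 "λ = ℓ" (arXiv:2308.07915 chunk p0011 L39)] -/
theorem addOrderOf_x_6_6 : addOrderOf (((1 : Fin 6), (0 : Fin 6)) - (2, 0)) = 6 :=
  (addOrderOf_eq_iff (by norm_num)).mpr (by decide)

/-- `ord((0,1) − (0,2)) = 3` in `ℤ₁₅ × ℤ₃`. [cite: BravyiEtAl2024, §5 after Lemma 4 (arXiv:2308.07915 chunk p0011 L39)] -/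
theorem addOrderOf_y_15_3 : addOrderOf (((0 : Fin 15), (1 : Fin 3)) - (0, 2)) = 3 :=
  (addOrderOf_eq_iff (by norm_num)).mpr (by decide)

/-- `ord((0,0) − (7,0)) = 15` in `ℤ₁₅ × ℤ₃` (`B₁B₃ᵀ = x⁻⁷`, order `ℓ = 15`). [cite: BravyiEtAl2024, §5 after Lemma 4 "the exception is the [[90,8,10]] code, for which we can take i = 2, g = 1 and j = h = 3" (arXiv:2308.07915 chunk p0011 L39)] -/
theorem addOrderOf_x7_15_3 : addOrderOf (((0 : Fin 15), (0 : Fin 3)) - (7, 0)) = 15 :=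
  (addOrderOf_eq_iff (by norm_num)).mpr (by decide)

/-- `ord((0,1) − (0,2)) = 6` in `ℤ₉ × ℤ₆`. [cite: BravyiEtAl2024, §5 after Lemma 4 (arXiv:2308.07915 chunk p0011 L39)] -/
theorem addOrderOf_y_9_6 : addOrderOf (((0 : Fin 9), (1 : Fin 6)) - (0, 2)) = 6 :=
  (addOrderOf_eq_iff (by norm_num)).mpr (by decide)

/-- `ord((1,0) − (2,0)) = 9` in `ℤ₉ × ℤ₆`. [cite: BravyiEtAl2024, §5 after Lemma 4 (arXiv:2308.07915 chunk p0011 L39)] -/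
theorem addOrderOf_x_9_6 : addOrderOf (((1 : Fin 9), (0 : Fin 6)) - (2, 0)) = 9 :=
  (addOrderOf_eq_iff (by norm_num)).mpr (by decide)

/-- `ord((0,1) − (0,2)) = 6` in `ℤ₁₂ × ℤ₆`. [cite: BravyiEtAl2024, §5 after Lemma 4 (arXiv:2308.07915 chunk p0011 L39)] -/
theorem addOrderOf_y_12_6 : addOrderOf (((0 : Fin 12), (1 : Fin 6)) - (0, 2)) = 6 :=
  (addOrderOf_eq_iff (by norm_num)).mpr (by decide)

/-- `ord((1,0) − (2,0)) = 12` in `ℤ₁₂ × ℤ₆`. [cite: BravyiEtAl2024, §5 after Lemma 4 (arXiv:2308.07915 chunk p0011 L39)] -/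
theorem addOrderOf_x_12_6 : addOrderOf (((1 : Fin 12), (0 : Fin 6)) - (2, 0)) = 12 :=
  (addOrderOf_eq_iff (by norm_num)).mpr (by decide)

/-- `ord((0,2) − (0,7)) = 12` in `ℤ₁₂ × ℤ₁₂` (`A₂A₃ᵀ = y²y⁻⁷ = y⁻⁵`, order `m = 12`). [cite: BravyiEtAl2024, §5 after Lemma 4 (arXiv:2308.07915 chunk p0011 L39)] -/
theorem addOrderOf_y5_12_12 : addOrderOf (((0 : Fin 12), (2 : Fin 12)) - (0, 7)) = 12 :=
  (addOrderOf_eq_iff (by norm_num)).mpr (by decide)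

/-- `ord((1,0) − (2,0)) = 12` in `ℤ₁₂ × ℤ₁₂`. [cite: BravyiEtAl2024, §5 after Lemma 4 (arXiv:2308.07915 chunk p0011 L39)] -/
theorem addOrderOf_x_12_12 : addOrderOf (((1 : Fin 12), (0 : Fin 12)) - (2, 0)) = 12 :=
  (addOrderOf_eq_iff (by norm_num)).mpr (by decide)

/-- `ord((0,1) − (0,2)) = 6` in `ℤ₃₀ × ℤ₆`. [cite: BravyiEtAl2024, §5 after Lemma 4 (arXiv:2308.07915 chunk p0011 L39)] -/
theorem addOrderOf_y_30_6 : addOrderOf (((0 : Fin 30), (1 : Fin 6)) - (0, 2)) = 6 :=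
  (addOrderOf_eq_iff (by norm_num)).mpr (by decide)

/-- `ord((25,0) − (26,0)) = 30` in `ℤ₃₀ × ℤ₆` (`B₂B₃ᵀ = x²⁵x⁻²⁶ = x⁻¹`, order `ℓ = 30`). [cite: BravyiEtAl2024, §5 after Lemma 4 (arXiv:2308.07915 chunk p0011 L39)] -/
theorem addOrderOf_x_30_6 : addOrderOf (((25 : Fin 30), (0 : Fin 6)) - (26, 0)) = 30 :=
  (addOrderOf_eq_iff (by norm_num)).mpr (by decide)

/-! ### `[[72,12,6]]` = `QC(x³+y+y², y³+x+x²)` on `ℤ₆ × ℤ₆` -/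

/-- The exponent differences `(0,1) − (0,2)` of `A` and `(1,0) − (2,0)` of `B` generate `ℤ₆ × ℤ₆`.
[cite: BravyiEtAl2024, Lemma 4 (i) for [[72,12,6]] (arXiv:2308.07915 chunk p0011 L29, L39)] -/
theorem bb72_closure_eq_top :
    AddSubgroup.closure ({((0 : Fin 6), (1 : Fin 6)) - (0, 2), ((1 : Fin 6), (0 : Fin 6)) - (2, 0)} :
      Set (Mono 6 6)) = ⊤ := by
  apply Code.addSubgroup_eq_top_of_unit_mem
  · have h := AddSubgroup.subset_closure (k := ({((0 : Fin 6), (1 : Fin 6)) - (0, 2),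
      ((1 : Fin 6), (0 : Fin 6)) - (2, 0)} : Set (Mono 6 6))) (Set.mem_insert_of_mem _ rfl)
    have e : (5 : ℕ) • (((1 : Fin 6), (0 : Fin 6)) - (2, 0)) = (1, 0) := by decide
    have h' := AddSubgroup.nsmul_mem _ h 5
    rw [e] at h'
    exact h'
  · have h := AddSubgroup.subset_closure (k := ({((0 : Fin 6), (1 : Fin 6)) - (0, 2),
      ((1 : Fin 6), (0 : Fin 6)) - (2, 0)} : Set (Mono 6 6))) (Set.mem_insert _ _)
    have e : (5 : ℕ) • (((0 : Fin 6), (1 : Fin 6)) - (0, 2)) = (0, 1) := by decide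
    have h' := AddSubgroup.nsmul_mem _ h 5
    rw [e] at h'
    exact h'

/-- **`[[72,12,6]]` has a connected Tanner graph** ("all codes in Table are connected"). PROVED.
[cite: BravyiEtAl2024, §5 "although all codes in Table are connected" + Lemma 3 (arXiv:2308.07915 chunk p0011 L7–10)] -/
theorem bb72_tannerGraph_connected : bb72.css.tannerGraph.Connected := by
  refine bb72.tannerGraph_connected_of_unit_mem (fun h => absurd (congrFun h (3, 0)) (by decide))
    (fun h => absurd (congrFun h (0, 3)) (by decide)) ?_ ?_
  · have e : ((1 : Fin 6), (0 : Fin 6)) = (2, 0) - (1, 0) := by decide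
    rw [e]; exact bb72.sub_mem_expDiffSubgroup_B (by decide) (by decide)
  · have e : ((0 : Fin 6), (1 : Fin 6)) = (0, 2) - (0, 1) := by decide
    rw [e]; exact bb72.sub_mem_expDiffSubgroup_A (by decide) (by decide)

/-- **`[[72,12,6]]` has a toric layout with `(μ, λ) = (m, ℓ) = (6, 6)`** (Lemma 4 with `i = g = 2`,
`j = h = 3`: `A₂A₃ᵀ = y⁻¹`, `B₂B₃ᵀ = x⁻¹`). PROVED.
[cite: BravyiEtAl2024, §5 "All codes in Table have a toric layout with μ = m and λ = ℓ" (arXiv:2308.07915 chunk p0011 L39)] -/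
theorem bb72_hasToricLayoutWith : HasToricLayoutWith 6 6 bb72.css.tannerGraph := by
  have h := bb72.hasToricLayoutWith_of_exponents (g := (0, 1)) (g' := (0, 2)) (h := (1, 0)) (h' := (2, 0))
    (by decide) (by decide) (by decide) (by decide) bb72_closure_eq_top
    (by rw [addOrderOf_y_6_6, addOrderOf_x_6_6])
  rwa [addOrderOf_y_6_6, addOrderOf_x_6_6] at h

/-- `[[72,12,6]]` has a toric layout. PROVED. [cite: BravyiEtAl2024, §5 (arXiv:2308.07915 chunk p0011 L39)] -/
theorem bb72_hasToricLayout : HasToricLayout bb72.css.tannerGraph :=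
  ⟨6, 6, by norm_num, by norm_num, bb72_hasToricLayoutWith⟩

/-! ### `[[90,8,10]]` = `QC(x⁹+y+y², 1+x²+x⁷)` on `ℤ₁₅ × ℤ₃` -/

/-- The exponent differences `(0,1) − (0,2)` of `A` and `(0,0) − (7,0)` of `B` generate `ℤ₁₅ × ℤ₃`.
[cite: BravyiEtAl2024, Lemma 4 (i) for [[90,8,10]] with i = 2, j = 3, g = 1, h = 3 (arXiv:2308.07915 chunk p0011 L29, L39)] -/
theorem bb90_closure_eq_top :
    AddSubgroup.closure ({((0 : Fin 15), (1 : Fin 3)) - (0, 2), ((0 : Fin 15), (0 : Fin 3)) - (7, 0)} :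
      Set (Mono 15 3)) = ⊤ := by
  apply Code.addSubgroup_eq_top_of_unit_mem
  · have h := AddSubgroup.subset_closure (k := ({((0 : Fin 15), (1 : Fin 3)) - (0, 2),
      ((0 : Fin 15), (0 : Fin 3)) - (7, 0)} : Set (Mono 15 3))) (Set.mem_insert_of_mem _ rfl)
    have e : (2 : ℕ) • (((0 : Fin 15), (0 : Fin 3)) - (7, 0)) = (1, 0) := by decide
    have h' := AddSubgroup.nsmul_mem _ h 2
    rw [e] at h'
    exact h'
  · have h := AddSubgroup.subset_closure (k := ({((0 : Fin 15), (1 : Fin 3)) - (0, 2),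
      ((0 : Fin 15), (0 : Fin 3)) - (7, 0)} : Set (Mono 15 3))) (Set.mem_insert _ _)
    have e : (2 : ℕ) • (((0 : Fin 15), (1 : Fin 3)) - (0, 2)) = (0, 1) := by decide
    have h' := AddSubgroup.nsmul_mem _ h 2
    rw [e] at h'
    exact h'

/-- **`[[90,8,10]]` has a connected Tanner graph.** PROVED.
[cite: BravyiEtAl2024, §5 "although all codes in Table are connected" + Lemma 3 (arXiv:2308.07915 chunk p0011 L7–10)] -/
theorem bb90_tannerGraph_connected : bb90.css.tannerGraph.Connected := by
  refine bb90.tannerGraph_connected_of_unit_mem (fun h => absurd (congrFun h (9, 0)) (by decide))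
    (fun h => absurd (congrFun h (0, 0)) (by decide)) ?_ ?_
  · have e : ((1 : Fin 15), (0 : Fin 3)) = (2 : ℕ) • (((0 : Fin 15), (0 : Fin 3)) - (7, 0)) := by decide
    rw [e]
    exact AddSubgroup.nsmul_mem _ (bb90.sub_mem_expDiffSubgroup_B (by decide) (by decide)) 2
  · have e : ((0 : Fin 15), (1 : Fin 3)) = (0, 2) - (0, 1) := by decide
    rw [e]; exact bb90.sub_mem_expDiffSubgroup_A (by decide) (by decide)

/-- **`[[90,8,10]]` has a toric layout with `(μ, λ) = (m, ℓ) = (3, 15)`** (Lemma 4 with `i = 2, j = 3`,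
`g = 1, h = 3`: `A₂A₃ᵀ = y⁻¹`, `B₁B₃ᵀ = x⁻⁷`). PROVED.
[cite: BravyiEtAl2024, §5 "The exception is the [[90,8,10]] code, for which we can take i=2, g=1 and j=h=3" (arXiv:2308.07915 chunk p0011 L39)] -/
theorem bb90_hasToricLayoutWith : HasToricLayoutWith 3 15 bb90.css.tannerGraph := by
  have h := bb90.hasToricLayoutWith_of_exponents (g := (0, 1)) (g' := (0, 2)) (h := (0, 0)) (h' := (7, 0))
    (by decide) (by decide) (by decide) (by decide) bb90_closure_eq_top
    (by rw [addOrderOf_y_15_3, addOrderOf_x7_15_3])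
  rwa [addOrderOf_y_15_3, addOrderOf_x7_15_3] at h

/-- `[[90,8,10]]` has a toric layout. PROVED. [cite: BravyiEtAl2024, §5 (arXiv:2308.07915 chunk p0011 L39)] -/
theorem bb90_hasToricLayout : HasToricLayout bb90.css.tannerGraph :=
  ⟨3, 15, by norm_num, by norm_num, bb90_hasToricLayoutWith⟩

/-! ### `[[108,8,10]]` = `QC(x³+y+y², y³+x+x²)` on `ℤ₉ × ℤ₆` -/

/-- The exponent differences `(0,1) − (0,2)` of `A` and `(1,0) − (2,0)` of `B` generate `ℤ₉ × ℤ₆`.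
[cite: BravyiEtAl2024, Lemma 4 (i) for [[108,8,10]] (arXiv:2308.07915 chunk p0011 L29, L39)] -/
theorem bb108_closure_eq_top :
    AddSubgroup.closure ({((0 : Fin 9), (1 : Fin 6)) - (0, 2), ((1 : Fin 9), (0 : Fin 6)) - (2, 0)} :
      Set (Mono 9 6)) = ⊤ := by
  apply Code.addSubgroup_eq_top_of_unit_mem
  · have h := AddSubgroup.subset_closure (k := ({((0 : Fin 9), (1 : Fin 6)) - (0, 2),
      ((1 : Fin 9), (0 : Fin 6)) - (2, 0)} : Set (Mono 9 6))) (Set.mem_insert_of_mem _ rfl)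
    have e : (8 : ℕ) • (((1 : Fin 9), (0 : Fin 6)) - (2, 0)) = (1, 0) := by decide
    have h' := AddSubgroup.nsmul_mem _ h 8
    rw [e] at h'
    exact h'
  · have h := AddSubgroup.subset_closure (k := ({((0 : Fin 9), (1 : Fin 6)) - (0, 2),
      ((1 : Fin 9), (0 : Fin 6)) - (2, 0)} : Set (Mono 9 6))) (Set.mem_insert _ _)
    have e : (5 : ℕ) • (((0 : Fin 9), (1 : Fin 6)) - (0, 2)) = (0, 1) := by decide
    have h' := AddSubgroup.nsmul_mem _ h 5
    rw [e] at h'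
    exact h'

/-- **`[[108,8,10]]` has a connected Tanner graph.** PROVED.
[cite: BravyiEtAl2024, §5 "although all codes in Table are connected" + Lemma 3 (arXiv:2308.07915 chunk p0011 L7–10)] -/
theorem bb108_tannerGraph_connected : bb108.css.tannerGraph.Connected := by
  refine bb108.tannerGraph_connected_of_unit_mem (fun h => absurd (congrFun h (3, 0)) (by decide))
    (fun h => absurd (congrFun h (0, 3)) (by decide)) ?_ ?_
  · have e : ((1 : Fin 9), (0 : Fin 6)) = (2, 0) - (1, 0) := by decide
    rw [e]; exact bb108.sub_mem_expDiffSubgroup_B (by decide) (by decide)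
  · have e : ((0 : Fin 9), (1 : Fin 6)) = (0, 2) - (0, 1) := by decide
    rw [e]; exact bb108.sub_mem_expDiffSubgroup_A (by decide) (by decide)

/-- **`[[108,8,10]]` has a toric layout with `(μ, λ) = (m, ℓ) = (6, 9)`** (Lemma 4, `i = g = 2`,
`j = h = 3`). PROVED. [cite: BravyiEtAl2024, §5 "All codes in Table have a toric layout with μ = m and λ = ℓ" (arXiv:2308.07915 chunk p0011 L39)] -/
theorem bb108_hasToricLayoutWith : HasToricLayoutWith 6 9 bb108.css.tannerGraph := by
  have h := bb108.hasToricLayoutWith_of_exponents (g := (0, 1)) (g' := (0, 2)) (h := (1, 0)) (h' := (2, 0))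
    (by decide) (by decide) (by decide) (by decide) bb108_closure_eq_top
    (by rw [addOrderOf_y_9_6, addOrderOf_x_9_6])
  rwa [addOrderOf_y_9_6, addOrderOf_x_9_6] at h

/-- `[[108,8,10]]` has a toric layout. PROVED. [cite: BravyiEtAl2024, §5 (arXiv:2308.07915 chunk p0011 L39)] -/
theorem bb108_hasToricLayout : HasToricLayout bb108.css.tannerGraph :=
  ⟨6, 9, by norm_num, by norm_num, bb108_hasToricLayoutWith⟩

/-! ### `[[144,12,12]]` = `QC(x³+y+y², y³+x+x²)` on `ℤ₁₂ × ℤ₆` -/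

/-- The exponent differences `(0,1) − (0,2)` of `A` and `(1,0) − (2,0)` of `B` generate `ℤ₁₂ × ℤ₆`.
[cite: BravyiEtAl2024, Lemma 4 (i) for [[144,12,12]] (arXiv:2308.07915 chunk p0011 L29, L39)] -/
theorem bb144_closure_eq_top :
    AddSubgroup.closure ({((0 : Fin 12), (1 : Fin 6)) - (0, 2), ((1 : Fin 12), (0 : Fin 6)) - (2, 0)} :
      Set (Mono 12 6)) = ⊤ := by
  apply Code.addSubgroup_eq_top_of_unit_mem
  · have h := AddSubgroup.subset_closure (k := ({((0 : Fin 12), (1 : Fin 6)) - (0, 2),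
      ((1 : Fin 12), (0 : Fin 6)) - (2, 0)} : Set (Mono 12 6))) (Set.mem_insert_of_mem _ rfl)
    have e : (11 : ℕ) • (((1 : Fin 12), (0 : Fin 6)) - (2, 0)) = (1, 0) := by decide
    have h' := AddSubgroup.nsmul_mem _ h 11
    rw [e] at h'
    exact h'
  · have h := AddSubgroup.subset_closure (k := ({((0 : Fin 12), (1 : Fin 6)) - (0, 2),
      ((1 : Fin 12), (0 : Fin 6)) - (2, 0)} : Set (Mono 12 6))) (Set.mem_insert _ _)
    have e : (5 : ℕ) • (((0 : Fin 12), (1 : Fin 6)) - (0, 2)) = (0, 1) := by decide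
    have h' := AddSubgroup.nsmul_mem _ h 5
    rw [e] at h'
    exact h'

/-- **`[[144,12,12]]` (the gross code) has a connected Tanner graph.** PROVED.
[cite: BravyiEtAl2024, §5 "although all codes in Table are connected" + Lemma 3 (arXiv:2308.07915 chunk p0011 L7–10)] -/
theorem bb144_tannerGraph_connected : bb144.css.tannerGraph.Connected := by
  refine bb144.tannerGraph_connected_of_unit_mem (fun h => absurd (congrFun h (3, 0)) (by decide))
    (fun h => absurd (congrFun h (0, 3)) (by decide)) ?_ ?_
  · have e : ((1 : Fin 12), (0 : Fin 6)) = (2, 0) - (1, 0) := by decide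
    rw [e]; exact bb144.sub_mem_expDiffSubgroup_B (by decide) (by decide)
  · have e : ((0 : Fin 12), (1 : Fin 6)) = (0, 2) - (0, 1) := by decide
    rw [e]; exact bb144.sub_mem_expDiffSubgroup_A (by decide) (by decide)

/-- **`[[144,12,12]]` has a toric layout with `(μ, λ) = (m, ℓ) = (6, 12)`** (Lemma 4, `i = g = 2`,
`j = h = 3`; the paper's worked example "A₃A₂ᵀ = y²y⁻¹ = y which has order m = 6"). PROVED.
[cite: BravyiEtAl2024, §5 "All codes in Table have a toric layout with μ = m and λ = ℓ" (arXiv:2308.07915 chunk p0011 L39) and proof of Lemma 2 example (chunk p0010 L85–87)] -/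
theorem bb144_hasToricLayoutWith : HasToricLayoutWith 6 12 bb144.css.tannerGraph := by
  have h := bb144.hasToricLayoutWith_of_exponents (g := (0, 1)) (g' := (0, 2)) (h := (1, 0)) (h' := (2, 0))
    (by decide) (by decide) (by decide) (by decide) bb144_closure_eq_top
    (by rw [addOrderOf_y_12_6, addOrderOf_x_12_6])
  rwa [addOrderOf_y_12_6, addOrderOf_x_12_6] at h

/-- `[[144,12,12]]` has a toric layout. PROVED. [cite: BravyiEtAl2024, §5 (arXiv:2308.07915 chunk p0011 L39)] -/
theorem bb144_hasToricLayout : HasToricLayout bb144.css.tannerGraph :=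
  ⟨6, 12, by norm_num, by norm_num, bb144_hasToricLayoutWith⟩

/-! ### `[[288,12,18]]` = `QC(x³+y²+y⁷, y³+x+x²)` on `ℤ₁₂ × ℤ₁₂` -/

/-- The exponent differences `(0,2) − (0,7)` of `A` and `(1,0) − (2,0)` of `B` generate `ℤ₁₂ × ℤ₁₂`.
[cite: BravyiEtAl2024, Lemma 4 (i) for [[288,12,18]] (arXiv:2308.07915 chunk p0011 L29, L39)] -/
theorem bb288_closure_eq_top :
    AddSubgroup.closure ({((0 : Fin 12), (2 : Fin 12)) - (0, 7), ((1 : Fin 12), (0 : Fin 12)) - (2, 0)} :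
      Set (Mono 12 12)) = ⊤ := by
  apply Code.addSubgroup_eq_top_of_unit_mem
  · have h := AddSubgroup.subset_closure (k := ({((0 : Fin 12), (2 : Fin 12)) - (0, 7),
      ((1 : Fin 12), (0 : Fin 12)) - (2, 0)} : Set (Mono 12 12))) (Set.mem_insert_of_mem _ rfl)
    have e : (11 : ℕ) • (((1 : Fin 12), (0 : Fin 12)) - (2, 0)) = (1, 0) := by decide
    have h' := AddSubgroup.nsmul_mem _ h 11
    rw [e] at h'
    exact h'
  · have h := AddSubgroup.subset_closure (k := ({((0 : Fin 12), (2 : Fin 12)) - (0, 7),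
      ((1 : Fin 12), (0 : Fin 12)) - (2, 0)} : Set (Mono 12 12))) (Set.mem_insert _ _)
    have e : (7 : ℕ) • (((0 : Fin 12), (2 : Fin 12)) - (0, 7)) = (0, 1) := by decide
    have h' := AddSubgroup.nsmul_mem _ h 7
    rw [e] at h'
    exact h'

/-- **`[[288,12,18]]` has a connected Tanner graph.** PROVED.
[cite: BravyiEtAl2024, §5 "although all codes in Table are connected" + Lemma 3 (arXiv:2308.07915 chunk p0011 L7–10)] -/
theorem bb288_tannerGraph_connected : bb288.css.tannerGraph.Connected := by
  refine bb288.tannerGraph_connected_of_unit_mem (fun h => absurd (congrFun h (3, 0)) (by decide))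
    (fun h => absurd (congrFun h (0, 3)) (by decide)) ?_ ?_
  · have e : ((1 : Fin 12), (0 : Fin 12)) = (2, 0) - (1, 0) := by decide
    rw [e]; exact bb288.sub_mem_expDiffSubgroup_B (by decide) (by decide)
  · have e : ((0 : Fin 12), (1 : Fin 12)) = (5 : ℕ) • (((0 : Fin 12), (7 : Fin 12)) - (0, 2)) := by decide
    rw [e]
    exact AddSubgroup.nsmul_mem _ (bb288.sub_mem_expDiffSubgroup_A (by decide) (by decide)) 5

/-- **`[[288,12,18]]` has a toric layout with `(μ, λ) = (m, ℓ) = (12, 12)`** (Lemma 4, `i = g = 2`,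
`j = h = 3`: `A₂A₃ᵀ = y²y⁻⁷`, `B₂B₃ᵀ = x⁻¹`). PROVED.
[cite: BravyiEtAl2024, §5 "All codes in Table have a toric layout with μ = m and λ = ℓ" (arXiv:2308.07915 chunk p0011 L39)] -/
theorem bb288_hasToricLayoutWith : HasToricLayoutWith 12 12 bb288.css.tannerGraph := by
  have h := bb288.hasToricLayoutWith_of_exponents (g := (0, 2)) (g' := (0, 7)) (h := (1, 0)) (h' := (2, 0))
    (by decide) (by decide) (by decide) (by decide) bb288_closure_eq_top
    (by rw [addOrderOf_y5_12_12, addOrderOf_x_12_12])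
  rwa [addOrderOf_y5_12_12, addOrderOf_x_12_12] at h

/-- `[[288,12,18]]` has a toric layout. PROVED. [cite: BravyiEtAl2024, §5 (arXiv:2308.07915 chunk p0011 L39)] -/
theorem bb288_hasToricLayout : HasToricLayout bb288.css.tannerGraph :=
  ⟨12, 12, by norm_num, by norm_num, bb288_hasToricLayoutWith⟩

/-! ### `[[360,12,≤24]]` = `QC(x⁹+y+y², y³+x²⁵+x²⁶)` on `ℤ₃₀ × ℤ₆` -/

/-- The exponent differences `(0,1) − (0,2)` of `A` and `(25,0) − (26,0)` of `B` generate `ℤ₃₀ × ℤ₆`.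
[cite: BravyiEtAl2024, Lemma 4 (i) for [[360,12,≤24]] (arXiv:2308.07915 chunk p0011 L29, L39)] -/
theorem bb360_closure_eq_top :
    AddSubgroup.closure ({((0 : Fin 30), (1 : Fin 6)) - (0, 2), ((25 : Fin 30), (0 : Fin 6)) - (26, 0)} :
      Set (Mono 30 6)) = ⊤ := by
  apply Code.addSubgroup_eq_top_of_unit_mem
  · have h := AddSubgroup.subset_closure (k := ({((0 : Fin 30), (1 : Fin 6)) - (0, 2),
      ((25 : Fin 30), (0 : Fin 6)) - (26, 0)} : Set (Mono 30 6))) (Set.mem_insert_of_mem _ rfl)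
    have e : (29 : ℕ) • (((25 : Fin 30), (0 : Fin 6)) - (26, 0)) = (1, 0) := by decide
    have h' := AddSubgroup.nsmul_mem _ h 29
    rw [e] at h'
    exact h'
  · have h := AddSubgroup.subset_closure (k := ({((0 : Fin 30), (1 : Fin 6)) - (0, 2),
      ((25 : Fin 30), (0 : Fin 6)) - (26, 0)} : Set (Mono 30 6))) (Set.mem_insert _ _)
    have e : (5 : ℕ) • (((0 : Fin 30), (1 : Fin 6)) - (0, 2)) = (0, 1) := by decide
    have h' := AddSubgroup.nsmul_mem _ h 5
    rw [e] at h'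
    exact h'

/-- **`[[360,12,≤24]]` has a connected Tanner graph.** PROVED.
[cite: BravyiEtAl2024, §5 "although all codes in Table are connected" + Lemma 3 (arXiv:2308.07915 chunk p0011 L7–10)] -/
theorem bb360_tannerGraph_connected : bb360.css.tannerGraph.Connected := by
  refine bb360.tannerGraph_connected_of_unit_mem (fun h => absurd (congrFun h (9, 0)) (by decide))
    (fun h => absurd (congrFun h (0, 3)) (by decide)) ?_ ?_
  · have e : ((1 : Fin 30), (0 : Fin 6)) = (26, 0) - (25, 0) := by decide
    rw [e]; exact bb360.sub_mem_expDiffSubgroup_B (by decide) (by decide)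
  · have e : ((0 : Fin 30), (1 : Fin 6)) = (0, 2) - (0, 1) := by decide
    rw [e]; exact bb360.sub_mem_expDiffSubgroup_A (by decide) (by decide)

/-- **`[[360,12,≤24]]` has a toric layout with `(μ, λ) = (m, ℓ) = (6, 30)`** (Lemma 4, `i = g = 2`,
`j = h = 3`: `A₂A₃ᵀ = y⁻¹`, `B₂B₃ᵀ = x⁻¹`). PROVED.
[cite: BravyiEtAl2024, §5 "All codes in Table have a toric layout with μ = m and λ = ℓ" (arXiv:2308.07915 chunk p0011 L39)] -/
theorem bb360_hasToricLayoutWith : HasToricLayoutWith 6 30 bb360.css.tannerGraph := by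
  have h := bb360.hasToricLayoutWith_of_exponents (g := (0, 1)) (g' := (0, 2)) (h := (25, 0)) (h' := (26, 0))
    (by decide) (by decide) (by decide) (by decide) bb360_closure_eq_top
    (by rw [addOrderOf_y_30_6, addOrderOf_x_30_6])
  rwa [addOrderOf_y_30_6, addOrderOf_x_30_6] at h

/-- `[[360,12,≤24]]` has a toric layout. PROVED. [cite: BravyiEtAl2024, §5 (arXiv:2308.07915 chunk p0011 L39)] -/
theorem bb360_hasToricLayout : HasToricLayout bb360.css.tannerGraph :=
  ⟨6, 30, by norm_num, by norm_num, bb360_hasToricLayoutWith⟩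

end Summit.Ventures.QEC.BB
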